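import Mathlib
import Summits.ValiantsHypothesis.ValiantsHypothesis.Theorems.BarrierLeverSuccinctHittingSetsForVPAffineSeeds
import Summits.ValiantsHypothesis.ValiantsHypothesis.Theorems.BarrierLeverSuccinctHittingSetsForVPStubReadOnceHit
import Summits.ValiantsHypothesis.ValiantsHypothesis.Theorems.BarrierLeverDefinableEquationsFullSupportAtTwo
import HarnessLib

/-!
# The succinct Shpilka–Volkovich generator at exponent 3: read-once distinguishers, products of
sparse distinguishers, and the level-one reduction (crux stmt-ValiantsHypothesis-14610 side;
docket 8745/8749 of seat val-np-p5)

**What is proved (unconditional; it does NOT close any item).** With the affine Lagrange seeds of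
`…AffineSeeds` (`Λ_σ = ∏_{r<n} R_x(σ_r)`, indicator property at the words of the monomials, each
value of the generator `f₀ + Σ_{j<t} w_j Λ_{σ_j}` of size
`≤ n² + (n+1)2^K + t(remTreeCost K + (n−1)) + t + 1 = O(t · n log² n)`, `f₀ = (1 + Σ x_i)^n` from
`FullSupportAtTwo`) the three generator rows of the tree move to exponent **3**:

* `exists_sparseGenerator_three`, `isSuccinctHittingSet_sparseProducts_three`,
  `not_isNaturalProof_prod_sparse_three` (products of `N^a`-sparse polynomials; `t = 2an`;
  tree: `…_four`, `…_five`, and FSV's `10`);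
* `readOnceHit_three`, `not_isNaturalProof_prop_three` (preprocessed read-once formulas; `t = 4n`; `n ≥ 2^14`);
* `levelOne_of_generator_annihilators_three` (`max 3 b`).

Thresholds: `n ≥ 2^20 (a+1)²` (`threshold_poly`; read-once: `n ≥ 2^14`, `threshold_two`), from the
count `n ≥ 2a(12K² + 30K + 1) + 2a + 6`, `K = ⌈log₂(n+1)⌉` (`GeneratorThree.size_budget`; also the
cruder `threshold` for `n ≥ 2^{max 18 (2a)}` via `cubic_le_two_pow`).  Exponent 3 is the floor of
seed-by-seed realisation of any shifted SV generator (`t ≥ 2n` seeds, each a product needing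
`n − 1` gates at generic parameters): reaching the open rung `b = 2` this way would need a JOINT
realisation of `2n` generic seeds in `≤ n²` gates (the grid values alone do fit, by the batching of
`…SparsityWallTwo`), for which no method is known.

Honest framing: 14610-side bookkeeping (chart rows at the rank-method census); nothing here bears
on the open cruxes 8745/8749 (open at `b = 2`, Chatterjee–Tengse §1.3) or on `VP ≠ VNP`.

References: [ForbesShpilkaVolk2018] §3, Construction 29, Cor. 34, Question 6;
[ShpilkaVolkovich2015] Thm. 1; [GathenGerhard2013] §10.1.
-/

-- layout Summits/ValiantsHypothesis/ValiantsHypothesis forces the duplicated namespace component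
set_option linter.dupNamespace false

noncomputable section

namespace Summit.ValiantsHypothesis.ValiantsHypothesis.Theorems.BarrierLever.SuccinctHittingSetsForVP

open Literature.Barriers.ValiantsHypothesis Literature.Computability.AlgebraicComplexity MvPolynomial

namespace GeneratorThree

/-! ### The count -/

/-- **The size budget at exponent 3**: with `2^K ≤ 2n` and
`n ≥ 2a(12K² + 30K + 1) + 2a + 6`,
`n² + ((n+1)2^K + 2an(remTreeCost K + (n−1)) + 2an) + 1 ≤ n³`. [folklore] -/
theorem size_budget {a n K : ℕ} (hn : 1 ≤ n) (h2K : 2 ^ K ≤ 2 * n)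
    (hg : 2 * a * (12 * K ^ 2 + 30 * K + 1) + 2 * a + 6 ≤ n) :
    n ^ 2 + ((n + 1) * 2 ^ K + 2 * a * n * (remTreeCost K + (n - 1)) + 2 * a * n) + 1 ≤ n ^ 3 := by
  rw [remTreeCost_eq]
  set Q := 12 * K ^ 2 + 30 * K + 1 with hQ
  have hR : (6 * K ^ 2 + 15 * K) * 2 ^ K + (n - 1) ≤ Q * n := by
    have h1 : (6 * K ^ 2 + 15 * K) * 2 ^ K ≤ (6 * K ^ 2 + 15 * K) * (2 * n) :=
      Nat.mul_le_mul_left _ h2K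
    have h4 : n - 1 ≤ n := Nat.sub_le n 1
    have h5 : Q * n = (6 * K ^ 2 + 15 * K) * (2 * n) + n := by rw [hQ]; ring
    rw [h5]; omega
  have h3 : (n + 1) * 2 ^ K ≤ 2 * n ^ 2 + 2 * n := by nlinarith
  have hnn : n ≤ n ^ 2 := by nlinarith
  have h6 : (2 + 2 * a) * n + 1 ≤ (2 * a + 3) * n ^ 2 := by nlinarith
  calc n ^ 2 + ((n + 1) * 2 ^ K + 2 * a * n * ((6 * K ^ 2 + 15 * K) * 2 ^ K + (n - 1)) + 2 * a * n) + 1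
      ≤ n ^ 2 + ((2 * n ^ 2 + 2 * n) + 2 * a * n * (Q * n) + 2 * a * n) + 1 := by
        gcongr
    _ = (3 + 2 * a * Q) * n ^ 2 + (2 + 2 * a) * n + 1 := by ring
    _ ≤ (3 + 2 * a * Q) * n ^ 2 + (2 * a + 3) * n ^ 2 := by linarith [h6]
    _ = (2 * a * Q + 2 * a + 6) * n ^ 2 := by ring
    _ ≤ n * n ^ 2 := Nat.mul_le_mul_right _ hg
    _ = n ^ 3 := by ring

/-- `12K³ + 30K² + 2K + 6 ≤ 2^{K-1}` for `K ≥ 18`. [folklore] -/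
theorem cubic_le_two_pow (K : ℕ) (hK : 18 ≤ K) :
    12 * K ^ 3 + 30 * K ^ 2 + 2 * K + 6 ≤ 2 ^ (K - 1) := by
  induction K, hK using Nat.le_induction with
  | base => norm_num
  | succ K hK ih =>
    have h3 : 2 ^ (K + 1 - 1) = 2 ^ (K - 1) * 2 := by
      rw [show K + 1 - 1 = (K - 1) + 1 by omega, pow_succ]
    rw [h3]
    nlinarith [ih, hK]

/-- **The threshold**: for `n ≥ 2^{max 18 (2a)}` and `K = ⌈log₂(n+1)⌉`: `n + 1 ≤ 2^K`, `2^K ≤ 2n`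
and `2a(12K² + 30K + 1) + 2a + 6 ≤ n`. [folklore] -/
theorem threshold {a n : ℕ} (hn : 2 ^ max 18 (2 * a) ≤ n) :
    n + 1 ≤ 2 ^ Nat.clog 2 (n + 1) ∧ 2 ^ Nat.clog 2 (n + 1) ≤ 2 * n ∧
      2 * a * (12 * Nat.clog 2 (n + 1) ^ 2 + 30 * Nat.clog 2 (n + 1) + 1) + 2 * a + 6 ≤ n := by
  set K := Nat.clog 2 (n + 1) with hKdef
  have hpow : n + 1 ≤ 2 ^ K := Nat.le_pow_clog one_lt_two _
  have hn1 : 1 ≤ n := le_trans Nat.one_le_two_pow hn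
  have hlt : 2 ^ (K - 1) < n + 1 := by
    have := Nat.pow_pred_clog_lt_self one_lt_two (x := n + 1) (by omega)
    simpa [Nat.pred_eq_sub_one] using this
  have hm : max 18 (2 * a) + 1 ≤ K := by
    by_contra h
    have hle : K ≤ max 18 (2 * a) := by omega
    have : 2 ^ K ≤ 2 ^ max 18 (2 * a) := Nat.pow_le_pow_right (by norm_num) hle
    omega
  have hK18 : 18 ≤ K := le_trans (le_trans (le_max_left _ _) (Nat.le_succ _)) hm
  have hKa : 2 * a ≤ K := le_trans (le_trans (le_max_right _ _) (Nat.le_succ _)) hm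
  have h2K : 2 ^ K ≤ 2 * n := by
    have : 2 ^ K = 2 * 2 ^ (K - 1) := by rw [← pow_succ']; congr 1; omega
    omega
  refine ⟨hpow, h2K, ?_⟩
  have hc := cubic_le_two_pow K hK18
  have h1 : 2 * a * (12 * K ^ 2 + 30 * K + 1) + 2 * a + 6 ≤ 12 * K ^ 3 + 30 * K ^ 2 + 2 * K + 6 := by
    nlinarith [hKa, Nat.zero_le K, Nat.zero_le a]
  omega


/-- `24(2m+21)² + 60(2m+21) + 10 ≤ 2^{m+18}` for all `m`. [folklore] -/
theorem quadm_le_two_pow (m : ℕ) : 24 * (2 * m + 21) ^ 2 + 60 * (2 * m + 21) + 10 ≤ 2 ^ (m + 18) := by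
  induction m with
  | zero => norm_num
  | succ m ih =>
    have h2 : 24 * (2 * (m + 1) + 21) ^ 2 + 60 * (2 * (m + 1) + 21) + 10 ≤
        2 * (24 * (2 * m + 21) ^ 2 + 60 * (2 * m + 21) + 10) := by ring_nf; omega
    calc 24 * (2 * (m + 1) + 21) ^ 2 + 60 * (2 * (m + 1) + 21) + 10
        ≤ 2 * (24 * (2 * m + 21) ^ 2 + 60 * (2 * m + 21) + 10) := h2
      _ ≤ 2 * 2 ^ (m + 18) := Nat.mul_le_mul_left 2 ih
      _ = 2 ^ (m + 1 + 18) := by rw [show m + 1 + 18 = (m + 18) + 1 by omega, pow_succ]; ring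

/-- **Polynomial threshold**: for `n ≥ 2^20 (a+1)²` and `K = ⌈log₂(n+1)⌉`: `n + 1 ≤ 2^K`, `2^K ≤ 2n`
and `2a(12K² + 30K + 1) + 2a + 6 ≤ n` (via `(a+1)² ≤ 2^{K−20}`, `a + 1 ≤ 2^{m+1}`, `K ≤ 2m + 21`,
`m = ⌊(K−20)/2⌋`). [folklore] -/
theorem threshold_poly {a n : ℕ} (hn : 2 ^ 20 * (a + 1) ^ 2 ≤ n) :
    n + 1 ≤ 2 ^ Nat.clog 2 (n + 1) ∧ 2 ^ Nat.clog 2 (n + 1) ≤ 2 * n ∧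
      2 * a * (12 * Nat.clog 2 (n + 1) ^ 2 + 30 * Nat.clog 2 (n + 1) + 1) + 2 * a + 6 ≤ n := by
  set K := Nat.clog 2 (n + 1) with hKdef
  have hpow : n + 1 ≤ 2 ^ K := Nat.le_pow_clog one_lt_two _
  have h20 : 2 ^ 20 ≤ n := le_trans (Nat.le_mul_of_pos_right _ (by positivity)) hn
  have hn1 : 1 ≤ n := le_trans Nat.one_le_two_pow h20
  have hlt : 2 ^ (K - 1) < n + 1 := by
    have := Nat.pow_pred_clog_lt_self one_lt_two (x := n + 1) (by omega)
    simpa [Nat.pred_eq_sub_one] using this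
  have hK21 : 21 ≤ K := by
    by_contra h
    have hle : K ≤ 20 := by omega
    have : 2 ^ K ≤ 2 ^ 20 := Nat.pow_le_pow_right (by norm_num) hle
    omega
  have h2K : 2 ^ K ≤ 2 * n := by
    have : 2 ^ K = 2 * 2 ^ (K - 1) := by rw [← pow_succ']; congr 1; omega
    omega
  refine ⟨hpow, h2K, ?_⟩
  -- `(a+1)² ≤ 2^(K-20)`
  have hsplit : 2 ^ K = 2 ^ 20 * 2 ^ (K - 20) := by rw [← pow_add]; congr 1; omega
  have hsq : (a + 1) ^ 2 ≤ 2 ^ (K - 20) := by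
    have h' : 2 ^ 20 * (a + 1) ^ 2 < 2 ^ 20 * 2 ^ (K - 20) := by rw [← hsplit]; omega
    exact le_of_lt (Nat.lt_of_mul_lt_mul_left h')
  set m := (K - 20) / 2 with hm
  have hKm : K ≤ 2 * m + 21 := by omega
  have ha1 : a + 1 ≤ 2 ^ (m + 1) := by
    have h1 : (a + 1) ^ 2 ≤ (2 ^ (m + 1)) ^ 2 := hsq.trans (by
      rw [← pow_mul]; exact Nat.pow_le_pow_right (by norm_num) (by omega))
    exact (Nat.pow_le_pow_iff_left (by norm_num)).mp h1
  have hq : 24 * K ^ 2 + 60 * K + 10 ≤ 2 ^ (m + 18) :=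
    le_trans (by nlinarith [hKm]) (quadm_le_two_pow m)
  have h2pow : 2 ^ (m + 1) * 2 ^ (m + 18) ≤ 2 ^ (K - 1) := by
    rw [← pow_add]; exact Nat.pow_le_pow_right (by norm_num) (by omega)
  have hg1 : 2 * a * (12 * K ^ 2 + 30 * K + 1) + 2 * a + 6 ≤ (a + 1) * (24 * K ^ 2 + 60 * K + 10) := by
    nlinarith
  calc 2 * a * (12 * K ^ 2 + 30 * K + 1) + 2 * a + 6
      ≤ (a + 1) * (24 * K ^ 2 + 60 * K + 10) := hg1
    _ ≤ 2 ^ (m + 1) * 2 ^ (m + 18) := Nat.mul_le_mul ha1 hq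
    _ ≤ 2 ^ (K - 1) := h2pow
    _ ≤ n := by omega

/-- `48K² + 120K + 14 ≤ 2^{K-1}` for `K ≥ 15`. [folklore] -/
theorem quad_le_two_pow_fifteen (K : ℕ) (hK : 15 ≤ K) :
    48 * K ^ 2 + 120 * K + 14 ≤ 2 ^ (K - 1) := by
  induction K, hK using Nat.le_induction with
  | base => norm_num
  | succ K hK ih =>
    have h3 : 2 ^ (K + 1 - 1) = 2 ^ (K - 1) * 2 := by
      rw [show K + 1 - 1 = (K - 1) + 1 by omega, pow_succ]
    rw [h3]
    nlinarith [ih, hK]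

/-- **The read-once threshold** (`a = 2`, `t = 4n` seeds): for `n ≥ 2^14` and `K = ⌈log₂(n+1)⌉`,
`n + 1 ≤ 2^K`, `2^K ≤ 2n` and `4(12K² + 30K + 1) + 10 ≤ n`. [folklore] -/
theorem threshold_two {n : ℕ} (hn : 2 ^ 14 ≤ n) :
    n + 1 ≤ 2 ^ Nat.clog 2 (n + 1) ∧ 2 ^ Nat.clog 2 (n + 1) ≤ 2 * n ∧
      2 * 2 * (12 * Nat.clog 2 (n + 1) ^ 2 + 30 * Nat.clog 2 (n + 1) + 1) + 2 * 2 + 6 ≤ n := by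
  set K := Nat.clog 2 (n + 1) with hKdef
  have hpow : n + 1 ≤ 2 ^ K := Nat.le_pow_clog one_lt_two _
  have hlt : 2 ^ (K - 1) < n + 1 := by
    have := Nat.pow_pred_clog_lt_self one_lt_two (x := n + 1) (by omega)
    simpa [Nat.pred_eq_sub_one] using this
  have hK15 : 15 ≤ K := by
    by_contra h
    have hle : K ≤ 14 := by omega
    have : 2 ^ K ≤ 2 ^ 14 := Nat.pow_le_pow_right (by norm_num) hle
    omega
  have h2K : 2 ^ K ≤ 2 * n := by
    have : 2 ^ K = 2 * 2 ^ (K - 1) := by rw [← pow_succ']; congr 1; omega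
    omega
  refine ⟨hpow, h2K, ?_⟩
  have hc := quad_le_two_pow_fifteen K hK15
  omega

end GeneratorThree

open Generator GeneratorThree AffineSeeds
open Summit.ValiantsHypothesis.ValiantsHypothesis.Theorems.BarrierLeverDefinableEquations.FullSupportAtTwo

/-! ### The generator at exponent 3 -/

/-- **The shifted succinct SV generator with affine Lagrange seeds at exponent 3.** For every `a`
and `n ≥ 2^20 (a+1)²` the generator `Γ_μ = coeff_μ f₀ + Σ_{j < 2an} W_j L_μ(Z_j)`
(`L_μ = AffineSeeds.Lmap`, `Z_j ∈ ℂ^n`) takes ALL its values in `coeff(SmallCircuits ℂ n 3)` and is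
annihilated by NO nonzero polynomial with at most `C(2n,n)^a` monomials (tree:
`exists_sparseGenerator_four` with separable-tensor seeds). [cite: ForbesShpilkaVolk2018, Construction 29 and Cor. 34] -/
theorem exists_sparseGenerator_three_of_le {a n : ℕ} (hn : 2 ^ 20 * (a + 1) ^ 2 ≤ n) :
    ∃ (t : ℕ) (Γ : degLEMonomials n → MvPolynomial (Fin t ⊕ (Fin t × Fin n)) ℂ),
      (∀ p : Fin t ⊕ (Fin t × Fin n) → ℂ, ∃ f ∈ SmallCircuits ℂ n 3,
          ∀ μ : degLEMonomials n,
            MvPolynomial.coeff (μ : Fin n →₀ ℕ) f = MvPolynomial.eval p (Γ μ)) ∧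
      ∀ D : MvPolynomial (degLEMonomials n) ℂ, D ≠ 0 →
        D.support.card ≤ Nat.choose (2 * n) n ^ a → MvPolynomial.aeval Γ D ≠ 0 := by
  obtain ⟨hpow, h2K, hg⟩ := threshold_poly hn
  have hn8 : 8 ≤ n := le_trans (by norm_num)
    (le_trans (Nat.le_mul_of_pos_right _ (by positivity)) hn : 2 ^ 20 ≤ n)
  have hn1 : 1 ≤ n := by omega
  obtain ⟨f₀, hf₀, hfull⟩ := exists_fullSupport_mem_smallCircuits_two hn8
  refine ⟨2 * a * n, fun μ => C (coeff (μ : Fin n →₀ ℕ) f₀) +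
      ∑ j : Fin (2 * a * n), X (Sum.inl j) * rename (fun z => Sum.inr (j, z)) (Lmap n μ),
    fun p => ?_, fun D hD0 hDa => ?_⟩
  · refine ⟨f₀ + ∑ j : Fin (2 * a * n), C (p (Sum.inl j)) * seed n (fun r => p (Sum.inr (j, r))),
      ⟨totalDegree_value_le n _ _ _ f₀ hf₀.1, ?_⟩, fun μ => coeff_value n _ p f₀ μ⟩
    refine (complexity_value_le n hn1 (Nat.clog 2 (n + 1)) hpow (2 * a * n) _ _ f₀).trans ?_
    exact le_trans (by have := hf₀.2; omega) (size_budget hn1 h2K hg)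
  · obtain ⟨m, hm, hmcard⟩ := Sparse.exists_narrow_monomial_shift hfull hD0
    have hcard : m.support.card ≤ 2 * a * n := GeneratorGlue.card_le_of_two_pow_le hmcard hDa
    obtain ⟨w, hw, hne⟩ := LowSupport.exists_eval_ne_zero_supported hm
    rw [ShiftedSupport.eval_shift] at hne
    exact stub_svHit (degLEMonomials n) (Fin n) (2 * a * n) (Lmap n)
      (fun ν r => ((word n ν r : ℕ) : ℂ)) (indicator n)
      (fun μ => coeff (μ : Fin n →₀ ℕ) f₀) D ⟨m.support, w, hcard, hw, hne⟩

/-- Eventual form. [cite: ForbesShpilkaVolk2018, Construction 29 and Cor. 34] -/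
theorem exists_sparseGenerator_three :
    ∀ a : ℕ, ∃ n₀ : ℕ, ∀ n : ℕ, n₀ ≤ n →
      ∃ (t : ℕ) (Γ : degLEMonomials n → MvPolynomial (Fin t ⊕ (Fin t × Fin n)) ℂ),
        (∀ p : Fin t ⊕ (Fin t × Fin n) → ℂ, ∃ f ∈ SmallCircuits ℂ n 3,
            ∀ μ : degLEMonomials n,
              MvPolynomial.coeff (μ : Fin n →₀ ℕ) f = MvPolynomial.eval p (Γ μ)) ∧
        ∀ D : MvPolynomial (degLEMonomials n) ℂ, D ≠ 0 →
          D.support.card ≤ Nat.choose (2 * n) n ^ a → MvPolynomial.aeval Γ D ≠ 0 :=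
  fun a => ⟨2 ^ 20 * (a + 1) ^ 2, fun _ hn => exists_sparseGenerator_three_of_le hn⟩

/-- **Products of sparse polynomials are hit by `SmallCircuits ℂ n 3`** (`n ≥ 2^20 (a+1)²`; tree:
`…_four`). [cite: ForbesShpilkaVolk2018, Cor. 34] -/
theorem isSuccinctHittingSet_sparseProducts_three_of_le {a n : ℕ} (hn : 2 ^ 20 * (a + 1) ^ 2 ≤ n) :
    IsSuccinctHittingSet (degLEMonomials n) (SmallCircuits ℂ n 3)
      {D | ∃ (k : ℕ) (E : Fin k → MvPolynomial (degLEMonomials n) ℂ),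
        D = ∏ j, E j ∧ ∀ j, (E j).support.card ≤ Nat.choose (2 * n) n ^ a} := by
  obtain ⟨t, Γ, hreal, hhit⟩ := exists_sparseGenerator_three_of_le (a := a) hn
  rintro D ⟨k, E, rfl, hE⟩ hD0
  have hE0 : ∀ j, E j ≠ 0 := fun j h0 => hD0 (Finset.prod_eq_zero (Finset.mem_univ j) h0)
  exact exists_mem_smallCircuits_of_aeval_ne_zero hreal (aeval_generator_ne_zero_of_prod hhit hE0 hE)

/-- Eventual form (tree: `isSuccinctHittingSet_sparseProducts_four/_five`, FSV's `10`).
[cite: ForbesShpilkaVolk2018, Cor. 34] -/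
theorem isSuccinctHittingSet_sparseProducts_three :
    ∀ a : ℕ, ∃ n₀ : ℕ, ∀ n : ℕ, n₀ ≤ n →
      IsSuccinctHittingSet (degLEMonomials n) (SmallCircuits ℂ n 3)
        {D | ∃ (k : ℕ) (E : Fin k → MvPolynomial (degLEMonomials n) ℂ),
          D = ∏ j, E j ∧ ∀ j, (E j).support.card ≤ Nat.choose (2 * n) n ^ a} :=
  fun a => ⟨2 ^ 20 * (a + 1) ^ 2, fun _ hn => isSuccinctHittingSet_sparseProducts_three_of_le hn⟩

/-- **No product of sparse polynomials is a natural proof against `SmallCircuits ℂ n b`, `b ≥ 3`.**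
[cite: ForbesShpilkaVolk2018, Def. 1 and Cor. 34] -/
theorem not_isNaturalProof_prod_sparse_three (a : ℕ) : ∃ n₀ : ℕ, ∀ n : ℕ, n₀ ≤ n → ∀ b : ℕ, 3 ≤ b →
    ∀ (𝒟 : Set (MvPolynomial (degLEMonomials n) ℂ)) (k : ℕ)
      (E : Fin k → MvPolynomial (degLEMonomials n) ℂ),
      (∀ j, (E j).support.card ≤ Nat.choose (2 * n) n ^ a) →
        ¬ IsNaturalProof (degLEMonomials n) (SmallCircuits ℂ n b) 𝒟 (∏ j, E j) := by
  refine ⟨2 ^ 20 * (a + 1) ^ 2, fun n hn b hb 𝒟 k E hE hnat => ?_⟩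
  have hn1 : 1 ≤ n :=
    le_trans Nat.one_le_two_pow (le_trans (Nat.le_mul_of_pos_right _ (by positivity)) hn)
  obtain ⟨f, hf, hne⟩ := isSuccinctHittingSet_sparseProducts_three_of_le hn (∏ j, E j)
    ⟨k, E, rfl, hE⟩ hnat.2.1
  exact hne (hnat.2.2 f (smallCircuits_mono ℂ hb hn1 hf))

/-! ### Read-once distinguishers at exponent 3 -/

/-- **Read-once (PROP) distinguishers are hit by `SmallCircuits ℂ n 3`** (`n ≥ 2^14`; `4n` seeds;
tree: `readOnceHit_four/_five`, `stub_readOnceHit` at `10`). [cite: ForbesShpilkaVolk2018, §3 and Construction 29]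
[cite: ShpilkaVolkovich2015, Thm. 1] -/
theorem readOnceHit_three_of_le {n : ℕ} (hn : 2 ^ 14 ≤ n) :
    IsSuccinctHittingSet (degLEMonomials n) (SmallCircuits ℂ n 3)
      {D | ∃ S : Finset (degLEMonomials n), IsPROP S D} := by
  intro D hD hD0
  obtain ⟨hpow, h2K, hg⟩ := threshold_two hn
  have hn1 : 1 ≤ n := le_trans Nat.one_le_two_pow hn
  have hn8 : 8 ≤ n := le_trans (by norm_num) hn
  obtain ⟨S, hS⟩ := hD
  obtain ⟨f₀, hf₀, -⟩ := exists_fullSupport_mem_smallCircuits_two hn8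
  haveI : Fintype (degLEMonomials n) := (GKSS2017.degLEMonomials_finite n).fintype
  have hcard : Fintype.card (degLEMonomials n) < 2 ^ (2 * 2 * n) := by
    rw [← Nat.card_eq_fintype_card, GKSS2017.card_degLEMonomials]
    calc (2 * n).choose n ≤ 2 ^ (2 * n) := Nat.choose_le_two_pow _ _
      _ < 2 ^ (2 * 2 * n) := Nat.pow_lt_pow_right (by norm_num) (by omega)
  have hgen := stub_readOnceGenerator (degLEMonomials n) (Fin n) (2 * 2 * n) (Lmap n)
    (fun ν r => ((word n ν r : ℕ) : ℂ)) (indicator n) hcard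
    (fun μ => coeff (μ : Fin n →₀ ℕ) f₀) D S hS hD0
  refine Generator.exists_mem_smallCircuits_of_aeval_ne_zero (fun p => ?_) hgen
  refine ⟨f₀ + ∑ j : Fin (2 * 2 * n), C (p (Sum.inl j)) * seed n (fun r => p (Sum.inr (j, r))),
    ⟨totalDegree_value_le n _ _ _ f₀ hf₀.1, ?_⟩, fun μ => coeff_value n _ p f₀ μ⟩
  refine (complexity_value_le n hn1 (Nat.clog 2 (n + 1)) hpow (2 * 2 * n) _ _ f₀).trans ?_
  exact le_trans (by have := hf₀.2; omega) (size_budget hn1 h2K hg)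

/-- Eventual form. [cite: ForbesShpilkaVolk2018, §3 and Construction 29] -/
theorem readOnceHit_three :
    ∃ n₀ : ℕ, ∀ n : ℕ, n₀ ≤ n → IsSuccinctHittingSet (degLEMonomials n) (SmallCircuits ℂ n 3)
      {D | ∃ S : Finset (degLEMonomials n), IsPROP S D} :=
  ⟨2 ^ 14, fun _ hn => readOnceHit_three_of_le hn⟩

/-- **No read-once-formula natural proof against `SmallCircuits ℂ n b`, `b ≥ 3`** (`n ≥ 2^14`).
[cite: ForbesShpilkaVolk2018, Thm. 4] -/
theorem not_isNaturalProof_prop_three :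
    ∃ n₀ : ℕ, ∀ n : ℕ, n₀ ≤ n → ∀ b : ℕ, 3 ≤ b →
      ∀ (𝒟 : Set (MvPolynomial (degLEMonomials n) ℂ)) (D : MvPolynomial (degLEMonomials n) ℂ)
        (S : Finset (degLEMonomials n)), IsPROP S D →
        ¬ IsNaturalProof (degLEMonomials n) (SmallCircuits ℂ n b) 𝒟 D := by
  refine ⟨2 ^ 14, fun n hn b hb 𝒟 D S hS hnat => ?_⟩
  obtain ⟨-, hD0, hvan⟩ := hnat
  obtain ⟨f, hf, hne⟩ := readOnceHit_three_of_le hn D ⟨S, hS⟩ hD0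
  exact hne (hvan f (smallCircuits_mono ℂ hb (le_trans Nat.one_le_two_pow hn) hf))

/-! ### Level one -/

/-- **Level one reduces to the annihilators of the generator, at exponent 3** (tree: `max 4 b`,
`max 5 b`, `max 10 b`). [cite: ForbesShpilkaVolk2018, §3 and Question 6] -/
theorem levelOne_of_generator_annihilators_three :
    ∃ n₀ : ℕ, ∀ n : ℕ, n₀ ≤ n →
      ∃ (t : ℕ) (Γ : degLEMonomials n → MvPolynomial (Fin t ⊕ (Fin t × Fin n)) ℂ),
        (∀ D : MvPolynomial (degLEMonomials n) ℂ, D ≠ 0 →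
          D.support.card ≤ Nat.choose (2 * n) n → aeval Γ D ≠ 0) ∧
        ∀ b : ℕ, IsSuccinctHittingSet (degLEMonomials n) (SmallCircuits ℂ n b)
            (Distinguishers ℂ n 1 ∩ {D | aeval Γ D = 0}) →
          IsSuccinctHittingSet (degLEMonomials n) (SmallCircuits ℂ n (max 3 b))
            (Distinguishers ℂ n 1) := by
  refine ⟨2 ^ 20 * (1 + 1) ^ 2, fun n hn => ?_⟩
  have hn1 : 1 ≤ n :=
    le_trans Nat.one_le_two_pow (le_trans (Nat.le_mul_of_pos_right _ (by positivity)) hn)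
  obtain ⟨t, Γ, hreal, hhit⟩ := exists_sparseGenerator_three_of_le (a := 1) hn
  refine ⟨t, Γ, fun D hD0 hD => hhit D hD0 (by simpa only [pow_one] using hD), fun b hres => ?_⟩
  exact isSuccinctHittingSet_of_annihilators hn1 hreal hres

end Summit.ValiantsHypothesis.ValiantsHypothesis.Theorems.BarrierLever.SuccinctHittingSetsForVP

end
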